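import Summits.FinalStateConjecture.FinalStateConjecture.Theses.LogTimeThreeAnnuli

/-!
# Route LogTimeThreeAnnuli — the assembly item

The assembly item `Assembly` of route `LogTimeThreeAnnuli` is, since the route repair of
2026-08-16 (rev 2; ledger item stmt-FinalStateConjecture-17492, replacing the curried
stmt-FinalStateConjecture-14487), the UNCURRIED implication
`SubconvergentEraGeneric ∧ DyadicCapture ∧ MGHDExists → FinalStateConjecture`.
This is pure logic: pointwise on the admissible class `MGHDExists` supplies the anti-vacuity
conjunct, `DyadicCapture` upgrades "every MGHD has complete 𝓘⁺ and an honest subconvergent final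
era" to the Statement's per-datum settling property, and tame Christodoulou genericity is monotone
under pointwise implication of properties, so the generic family of `SubconvergentEraGeneric`
serves verbatim.  The route file's sorry-free deciding theorem `closes` is literally the curried
form of this implication; we record its uncurrying under the item's name.  (This module imports the
route file, so the route file records the closure as `proved by … @ commit` rather than by a
`_holds` link.)
-/

-- `Summit.<Summit>.<Problem>` is the tree's mandated summit-side namespace (CONVENTIONS §2); for this
-- single-conjunct summit the two coincide, so the duplicate is deliberate.
set_option linter.dupNamespace false

namespace Summit.FinalStateConjecture.FinalStateConjecture.Theorems

open Summit.FinalStateConjecture.FinalStateConjecture.Theses.LogTimeThreeAnnuli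

/-- The assembly of route `LogTimeThreeAnnuli` (item stmt-FinalStateConjecture-17492):
`SubconvergentEraGeneric ∧ DyadicCapture ∧ MGHDExists → FinalStateConjecture`.
Proof: unfold `Assembly`, split the conjunction and apply the route's deciding theorem
`Summit.FinalStateConjecture.FinalStateConjecture.Theses.LogTimeThreeAnnuli.closes`
(`SubconvergentEraGeneric → DyadicCapture → MGHDExists → FinalStateConjecture`: fix a 3-manifold
`X` and a datum `d` exceptional for the Statement's property; `MGHDExists` gives the existence
conjunct and `DyadicCapture` turns the subconvergent era of every MGHD into the Statement's
decomposition, so `d` is exceptional for the property of `SubconvergentEraGeneric`, whose generic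
family through `d` is returned unchanged). -/
theorem logTimeThreeAnnuli_assembly_proof :
    Summit.FinalStateConjecture.FinalStateConjecture.Theses.LogTimeThreeAnnuli.Assembly := by
  unfold Summit.FinalStateConjecture.FinalStateConjecture.Theses.LogTimeThreeAnnuli.Assembly
  rintro ⟨hG, hC, hM⟩
  exact Summit.FinalStateConjecture.FinalStateConjecture.Theses.LogTimeThreeAnnuli.closes hG hC hM

end Summit.FinalStateConjecture.FinalStateConjecture.Theorems
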